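import Summits.CriticalPhenomena.PercolationContinuityZ3.Theorems.Transplant.CayleyZSqCriticalProbLtOne
import Summits.CriticalPhenomena.PercolationContinuityZ3.Theorems.Transplant.CayleyVirtuallyCyclicCriticalProbOne
import Mathlib.GroupTheory.SemidirectProduct
import HarnessLib

/-!
# Benjamini–Schramm's Conjecture 1 for VIRTUALLY ABELIAN groups, kernel and in `⟺` form: a group with a finite-index subgroup `≅ ℤ^d` has
# `p_c(Cay(Γ; S)) < 1` for one (every) finite generating set iff `d ≥ 2` (unconditional)

builds on p205010 (kernel theorem, internal audit signed; external expert review pending) — nothing in this file uses p205010; unconditional, no node.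
Lane `prim-bschramm`, seat `prim-bschramm-p4` gen 22 (PART C3 of `P4-GENERAL.md` §44).  Helper file (`--supports stmt-CriticalPhenomena-4575 --as helper`).

THE POINT.  The two gen-22 kernel facts `CayleyZSq.criticalProb_lt_one` (an embedded `ℤ²` forces `p_c < 1` for every `S`) and
`VirtCyc.criticalProb_eq_one_of_zpowers_finiteIndex` (a finite-index cyclic subgroup forces `p_c = 1` for every `S`) assemble into the exact
dichotomy for the class that carries the WALL of the C3 class map (crystallographic groups of every dimension, `ℤ² ⋊ C₄`, the Hantzsche–Wendt
group, the screw groups `ℤ² ⋊_M ℤ`, every `F × ℤ^d`, …): **`VirtAbelian.criticalProb_lt_one_iff_two_le` — if `A ≤ Γ` has finite index and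
`A ≃ ℤ^d` (`Multiplicative (Fin d → ℤ) ≃* A`), then for every finite generating `S` and every vertex `g`, `p_c(Cay(Γ; S), g) < 1 ⟺ 2 ≤ d`**;
equivalently `p_c = 1 ⟺ d ≤ 1` (`criticalProb_eq_one_iff_le_one`); injective-homomorphism form `criticalProb_lt_one_iff_two_le_of_injective`.
So on this class Conjecture 4's hypothesis `p_c < 1` is DECIDED by the rank `d` (kernel), independently of `S` — the wall (`d ≥ 2`,
`b₁(Γ) ≤ 1`) is inside the hypothesis, the rest (`d ≤ 1`) is vacuous.
* `zpowers_eq_of_rank_le_one` (for `d ≤ 1` the image of `ℤ^d` is cyclic), `exists_pair_of_two_le` (for `d ≥ 2` the images of `e₀, e₁` are an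
  embedded `ℤ²`), **`criticalProb_lt_one_iff_two_le`**, `criticalProb_eq_one_iff_le_one`, `criticalProb_lt_one_iff_two_le_of_injective`;
  rank form without finite index `criticalProb_lt_one_of_injective_hom_rank` and its instances `criticalProb_lt_one_semidirect` (`ℤ^d ⋊ K`,
  `d ≥ 2`: screw/glide groups, `ℤ² ⋊ C₄`, split space groups) and `criticalProb_lt_one_prod(')` (`ℤ^d × K`, any generating set of the product).
[cite: BenjaminiSchramm1996, §2 Conj. 1 and the remark after it] [cite: LyonsPeres2016, §7.4 Thm. 7.15, Thm. 7.16, Cor. 7.19]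
-/

noncomputable section

namespace Summit.CriticalPhenomena.PercolationContinuityZ3.Theorems.Transplant
open SimpleGraph Literature.Probability.LatticeModels Literature.Probability.Percolation
open scoped Classical

namespace VirtAbelian

variable {Γ : Type} [Group Γ] {d : ℕ}

/-- For `d ≤ 1` every vector of `ℤ^d` is an integer multiple of the all-ones vector. [folklore] -/
theorem exists_eq_smul_ones_of_le_one (hd : d ≤ 1) (x : Fin d → ℤ) : ∃ k : ℤ, x = k • fun _ => (1 : ℤ) := by
  rcases Nat.lt_or_ge d 1 with h0 | h1
  · have hd0 : d = 0 := by omega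
    subst hd0
    exact ⟨0, funext fun i => i.elim0⟩
  · have hd1 : d = 1 := le_antisymm hd h1
    subst hd1
    refine ⟨x 0, funext fun i => ?_⟩
    have hi : i = 0 := Fin.ext (by have := i.isLt; omega)
    rw [hi, Pi.smul_apply, smul_eq_mul, mul_one]

/-- **`d ≤ 1`: the image of `ℤ^d` is the cyclic group generated by the image of the all-ones vector.** [folklore] -/
theorem zpowers_eq_of_rank_le_one (hd : d ≤ 1) (A : Subgroup Γ) (e : Multiplicative (Fin d → ℤ) ≃* A) :
    Subgroup.zpowers ((e (Multiplicative.ofAdd fun _ => (1 : ℤ)) : A) : Γ) = A := by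
  apply le_antisymm
  · rw [Subgroup.zpowers_le]; exact Subtype.coe_prop _
  · intro a ha
    obtain ⟨k, hk⟩ := exists_eq_smul_ones_of_le_one hd (Multiplicative.toAdd (e.symm ⟨a, ha⟩))
    refine Subgroup.mem_zpowers_iff.2 ⟨k, ?_⟩
    have h1 : (⟨a, ha⟩ : A) = e (Multiplicative.ofAdd (Multiplicative.toAdd (e.symm ⟨a, ha⟩))) := by
      rw [ofAdd_toAdd, MulEquiv.apply_symm_apply]
    have h2 : Multiplicative.ofAdd (Multiplicative.toAdd (e.symm ⟨a, ha⟩)) = (Multiplicative.ofAdd fun _ => (1 : ℤ)) ^ k := by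
      rw [hk, ofAdd_zsmul]
    have h3 : a = ((e (Multiplicative.ofAdd fun _ => (1 : ℤ)) ^ k : A) : Γ) := by
      rw [← map_zpow, ← h2, ← h1]
    rw [h3, Subgroup.coe_zpow]

/-- **`d ≥ 2`: the images of `e₀, e₁` are an embedded `ℤ²`** — they commute and have independent powers. [folklore] -/
theorem exists_pair_of_two_le (hd : 2 ≤ d) (A : Subgroup Γ) (e : Multiplicative (Fin d → ℤ) ≃* A) :
    ∃ a b : Γ, Commute a b ∧ ∀ m n : ℤ, a ^ m * b ^ n = 1 → m = 0 ∧ n = 0 := by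
  set i0 : Fin d := ⟨0, by omega⟩ with hi0
  set i1 : Fin d := ⟨1, by omega⟩ with hi1
  have h01 : i0 ≠ i1 := by rw [hi0, hi1]; exact fun h => by simpa using congrArg Fin.val h
  set x : Multiplicative (Fin d → ℤ) := Multiplicative.ofAdd (Pi.single i0 1) with hx
  set y : Multiplicative (Fin d → ℤ) := Multiplicative.ofAdd (Pi.single i1 1) with hy
  refine ⟨(e x : Γ), (e y : Γ), ?_, fun m n h => ?_⟩
  · have hc : Commute (e x) (e y) := (Commute.all x y).map e
    exact congrArg Subtype.val hc.eq
  · have h1 : ((e (x ^ m * y ^ n) : A) : Γ) = 1 := by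
      rw [map_mul, map_zpow, map_zpow, Subgroup.coe_mul, Subgroup.coe_zpow, Subgroup.coe_zpow]; exact h
    have h2 : e (x ^ m * y ^ n) = 1 := Subtype.ext h1
    have h3 : x ^ m * y ^ n = 1 := by rw [← e.map_eq_one_iff]; exact h2
    have h4 := congrArg Multiplicative.toAdd h3
    rw [toAdd_mul, toAdd_zpow, toAdd_zpow, hx, hy, toAdd_ofAdd, toAdd_ofAdd, toAdd_one] at h4
    have e0 := congrFun h4 i0
    have e1 := congrFun h4 i1
    simp only [Pi.add_apply, Pi.smul_apply, Pi.single_eq_same, Pi.single_eq_of_ne h01, Pi.single_eq_of_ne h01.symm, smul_eq_mul,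
      mul_one, mul_zero, add_zero, zero_add, Pi.zero_apply] at e0 e1
    exact ⟨e0, e1⟩

/-- **THEOREM (Benjamini–Schramm's Conjecture 1 for virtually abelian groups, kernel, `⟺` form).**  `A ≤ Γ` of finite index, `A ≃ ℤ^d`, `S` any
finite generating set, `g` any vertex: `p_c(Cay(Γ; S), g) < 1 ⟺ 2 ≤ d`.  (`⟸`: the embedded `ℤ²`, `CayleyZSq.criticalProb_lt_one`; `⟹`: for
`d ≤ 1` the image is a finite-index cyclic subgroup, `VirtCyc.criticalProb_eq_one_of_zpowers_finiteIndex`.)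
[cite: BenjaminiSchramm1996, §2 Conj. 1 and the remark after it] [cite: LyonsPeres2016, §7.4 Thm. 7.15, Thm. 7.16, Cor. 7.19] -/
theorem criticalProb_lt_one_iff_two_le (S : Finset Γ) (hS : Subgroup.closure (S : Set Γ) = ⊤) (A : Subgroup Γ) [A.FiniteIndex]
    (e : Multiplicative (Fin d → ℤ) ≃* A) (g : Γ) : criticalProb (mulCayley (↑S : Set Γ)) g < 1 ↔ 2 ≤ d := by
  constructor
  · intro hpc
    by_contra hd
    have hd' : d ≤ 1 := by omega
    have hz := zpowers_eq_of_rank_le_one hd' A e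
    haveI : (Subgroup.zpowers ((e (Multiplicative.ofAdd fun _ => (1 : ℤ)) : A) : Γ)).FiniteIndex := by rw [hz]; infer_instance
    have h1 := VirtCyc.criticalProb_eq_one_of_zpowers_finiteIndex S hS _ this g
    exact absurd hpc (by rw [h1]; exact lt_irrefl 1)
  · intro hd
    obtain ⟨a, b, hab, hind⟩ := exists_pair_of_two_le hd A e
    exact CayleyZSq.criticalProb_lt_one S hS hab hind g

/-- **… equivalently `p_c = 1 ⟺ d ≤ 1`.** [cite: BenjaminiSchramm1996, §2 Conj. 1] -/
theorem criticalProb_eq_one_iff_le_one (S : Finset Γ) (hS : Subgroup.closure (S : Set Γ) = ⊤) (A : Subgroup Γ) [A.FiniteIndex]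
    (e : Multiplicative (Fin d → ℤ) ≃* A) (g : Γ) : criticalProb (mulCayley (↑S : Set Γ)) g = 1 ↔ d ≤ 1 := by
  have hle : criticalProb (mulCayley (↑S : Set Γ)) g ≤ 1 := (criticalProb_mem_Icc _ _).2
  have h := criticalProb_lt_one_iff_two_le S hS A e g
  constructor
  · intro h1; by_contra hd; exact absurd (h.2 (by omega)) (by rw [h1]; exact lt_irrefl 1)
  · intro hd; by_contra hne; have := h.1 (lt_of_le_of_ne hle hne); omega

/-- **Injective-homomorphism form**: `φ : ℤ^d → Γ` injective with image of finite index: `p_c(Cay(Γ; S), g) < 1 ⟺ 2 ≤ d`.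
[cite: BenjaminiSchramm1996, §2 Conj. 1 and the remark after it] -/
theorem criticalProb_lt_one_iff_two_le_of_injective (S : Finset Γ) (hS : Subgroup.closure (S : Set Γ) = ⊤)
    (φ : Multiplicative (Fin d → ℤ) →* Γ) (hφ : Function.Injective φ) (hfi : φ.range.FiniteIndex) (g : Γ) :
    criticalProb (mulCayley (↑S : Set Γ)) g < 1 ↔ 2 ≤ d := by
  haveI := hfi
  exact criticalProb_lt_one_iff_two_le S hS φ.range (MonoidHom.ofInjective hφ) g

/-- **Rank form (no finite index needed): an injective `ℤ^d → Γ` with `d ≥ 2` forces `p_c(Cay(Γ; S), g) < 1`** for every finite generating `S`.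
[cite: BenjaminiSchramm1996, §2 Conj. 1 and the remark after it] [cite: LyonsPeres2016, §7.4 Thm. 7.15–7.16] -/
theorem criticalProb_lt_one_of_injective_hom_rank (S : Finset Γ) (hS : Subgroup.closure (S : Set Γ) = ⊤)
    (φ : Multiplicative (Fin d → ℤ) →* Γ) (hφ : Function.Injective φ) (hd : 2 ≤ d) (g : Γ) : criticalProb (mulCayley (↑S : Set Γ)) g < 1 := by
  obtain ⟨a, b, hab, hind⟩ := exists_pair_of_two_le hd φ.range (MonoidHom.ofInjective hφ)
  exact CayleyZSq.criticalProb_lt_one S hS hab hind g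

/-- **Semidirect products `ℤ^d ⋊ K`, `d ≥ 2` (every action, every `K`): `p_c < 1` for every finite generating set** — the screw/glide groups
`ℤ² ⋊_M ℤ`, the rotor group `ℤ² ⋊ C₄`, every split crystallographic group. [cite: BenjaminiSchramm1996, §2 Conj. 1 and the remark after it] -/
theorem criticalProb_lt_one_semidirect {K : Type} [Group K] (φ : K →* MulAut (Multiplicative (Fin d → ℤ))) (hd : 2 ≤ d)
    (S : Finset (Multiplicative (Fin d → ℤ) ⋊[φ] K)) (hS : Subgroup.closure (S : Set (Multiplicative (Fin d → ℤ) ⋊[φ] K)) = ⊤)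
    (g : Multiplicative (Fin d → ℤ) ⋊[φ] K) : criticalProb (mulCayley (↑S : Set (Multiplicative (Fin d → ℤ) ⋊[φ] K))) g < 1 :=
  criticalProb_lt_one_of_injective_hom_rank S hS SemidirectProduct.inl SemidirectProduct.inl_injective hd g

/-- **Direct products `ℤ^d × K` and `K × ℤ^d`, `d ≥ 2`: `p_c < 1` for every finite generating set of the product** (not only product
generating sets). [cite: BenjaminiSchramm1996, §2 Conj. 1 and the remark after it] -/
theorem criticalProb_lt_one_prod {K : Type} [Group K] (hd : 2 ≤ d) (S : Finset (Multiplicative (Fin d → ℤ) × K))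
    (hS : Subgroup.closure (S : Set (Multiplicative (Fin d → ℤ) × K)) = ⊤) (g : Multiplicative (Fin d → ℤ) × K) :
    criticalProb (mulCayley (↑S : Set (Multiplicative (Fin d → ℤ) × K))) g < 1 :=
  criticalProb_lt_one_of_injective_hom_rank S hS (MonoidHom.inl _ K) (fun x y h => by simpa using congrArg Prod.fst h) hd g

/-- Same with the factors swapped. [cite: BenjaminiSchramm1996, §2 Conj. 1 and the remark after it] -/
theorem criticalProb_lt_one_prod' {K : Type} [Group K] (hd : 2 ≤ d) (S : Finset (K × Multiplicative (Fin d → ℤ)))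
    (hS : Subgroup.closure (S : Set (K × Multiplicative (Fin d → ℤ))) = ⊤) (g : K × Multiplicative (Fin d → ℤ)) :
    criticalProb (mulCayley (↑S : Set (K × Multiplicative (Fin d → ℤ)))) g < 1 :=
  criticalProb_lt_one_of_injective_hom_rank S hS (MonoidHom.inr K _) (fun x y h => by simpa using congrArg Prod.snd h) hd g

end VirtAbelian

end Summit.CriticalPhenomena.PercolationContinuityZ3.Theorems.Transplant
end
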